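import Summits.QuantumFields.YangMills.Theorems.UnitScaleTiltProp7Crit93OfEq111T3
import Summits.QuantumFields.YangMills.Theorems.UnitScaleTiltProp7ActionLatticeTransportT3
import Summits.QuantumFields.YangMills.Theorems.UnitScaleTiltProp7SectET3WilsonHessianT3CetaRows
import Summits.QuantumFields.YangMills.Theorems.UnitScaleTiltProp7SectET3DeltaPiT3PInv
import HarnessLib

/-!
# Route `UnitScaleTilt`, crux «MinimiserStabilityRegPr» (stmt-QuantumFields-19200, stub EX `stub_existenceMinimalOrbit`, route (α)) — «H74-MEMBER»: **THE ROW (r74) OF THE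
# LATTICE (84) AT THE T³ MEMBER** — [Balaban1985BackgroundPropagators] (3.119) ∕ [Balaban1985Variational] (87) «⟨Y, Δ_π Y⟩ = ⟨Y, ΔY⟩ on the Landau subspace», in the currency of
# lit `B11Eq81ExpansionZpow.hasDerivAt_actionZ_chartRay_real`'s hypothesis `h74 : ∀ Y, P Y → pair27 τ (Δπ Y) (flat115 Y) = hessPair Tsh (Ucur U₀) η 3 τ (curL (flat115 Y))`

Cell `ym3-torus` (HUMAN RULING D-0037, YM ladder rung R3 — YM₃ on T³, NOT d = 4, NOT Clay; YM gap NOT proved), width seat `ym3-torus-px21` gen 2 (explicit-unit helper; lineage `hCrit93′`: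
✓`Prop7Crit93OfEq111` (door), ✓`Prop7ActionGradCurrent`, ✓`Prop7ActionLatticeTransport` (act), ✓`Prop7Crit93AtMemberOfRow84` (assembly)); EX namer ★`ym-ust-19200-w2` g6 word
2026-08-28T20:48:46Z «px21: H74-MEMBER + HCHART-CONT GO».  THEOREMS ONLY (0 `def`, 0 `sorry`); `--supports stmt-QuantumFields-19200 --as helper`, count-neutral; NO claim on crux ∕ stub ∕ registry.

THE PRINT.  [Balaban1985Variational] p. 289–290: «½⟨A, ΔA⟩ = ½⟨A, Δ_πA⟩ for A satisfying (76)–(77)» ((74) → (81), the row (r74) of lit `B11Eq81ExpansionZpow`); [Balaban1985BackgroundPropagators]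
(3.119) p. 419: «⟨A, Δ_πA⟩ = ⟨A − DG′RD*A, Δ(A − DG′RD*A)⟩», so that `Δ_π = Pᵀ Δ P`, `P = 1 − DG′R_SD*`, and `P A = A` whenever `R_SD*A = 0`; (3.10)–(3.12) p. 392 (the Hessian
`⟨A, ΔA⟩ = ⟨A, D*D_UA⟩ + ⟨A, Δ′A⟩` of the Wilson action).  At the member the assembly ✓`Prop7Crit93AtMemberOfRow84.deriv_chartRay_eq_zero_of_eq111_of_hasDerivAt_actionZ` consumes the
lattice (84) row `hZ`, whose supplier lit `hasDerivAt_actionZ_chartRay_real` displays (r74) for an abstract gauge predicate `P`; this file discharges (r74) for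
`P Y := IsLandauPrintS … U₀ (ιY) ∧ (∀ b, star (ιY b) = ιY b)` (Landau + Hermitian, `ιY := (JetSup.equiv Y) ∘ bondEquiv`), GENERIC IN THE SLOT (any `L²` operator `T` that agrees
with `Δ^η(U₀)` as a quadratic form on the Landau subspace — instances: `DeltaPiSlot` (3.119), its pinv twin `DeltaPiSlotP` (★★OWNER RULING g28-№4 (C2′)), and `DeltaEtaSlot`).

WHAT IS PROVED (member `F`, `K n`; `U₀ : GaugeField (F.P K) 0 SU(2)`; `η := L^{−(K−n)}` = `eta F n K`; `τ₂ := tr` on `M₂(ℂ)`; ns `…Theorems.Prop7Row74AtMember`):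
* §1 LATTICE BOOKKEEPING for lit's `hessPair` ((3.10), `B9Eq39Adjoint`): `hessPair_smul_tau` (linearity in `τ`), ★`hessPair_eta_scale` (homogeneity `hessPair T U η d τ A =
  η^d·η⁻²·hessPair T U 1 d τ A`), the letter transports `curl_Tsh_bgOfCfg`, `lettersA_Tsh_bgOfCfg`, `plaqU_Tsh_bgOfCfg` between lit's `TSite` reading at `bgOfCfg F K U₀` and the
  route lattice `torusT` at `bgUnits F K U₀`, and ★★`hessPair_Tsh_bgOfCfg_eq` — `hessPair Tsh (Ucur (bgOfCfg U₀)) η 3 τ (curL A) = hessPair torusT (bgUnits U₀) η 3 τ (formComp (A ∘ bondEquiv))`.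
* §2 (3.119) IN `L²` LETTERS: `gaugeCorr_eq_self_of_landau` ∕ `gaugeCorrP_eq_self_of_landau` (`P v = v` for `R_SD*v = 0`), ★`inner_DeltaPi_of_landau` ∕ ★`inner_DeltaPiP_of_landau`
  (`⟪v′, Δ_π v⟫ = ⟪v′, Δ^η v⟫` for Landau `v′ v`), ★★`inner_toL2_DeltaEta_toL2_eq_hessPair` — for Hermitian `X`: `⟪toL2 X, Δ^η(U₀)(toL2 X)⟫ = (c₀∕η²)·hessPair torusT (bgUnits U₀) 1 3 τ₂ (formComp X)`
  (✓`inner_toL2_DeltaEta_toL2` + reality ✓`hessFormRe_conj` + ✓`hessFormRe_self_eq_neg_hessPair`).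
* §3 ★★★`pair27_eq_hessPair_of_landau` — THE ROW (r74) AT THE MEMBER, generic slot `T` with `hT : ∀ v, R_S D* v = 0 → ⟪v, T v⟫ = ⟪v, Δ^η v⟫`:
  `pair27 τ₂ (currentCLM … T Y) (flat115 Y) = hessPair Tsh (Ucur (bgOfCfg F K U₀)) η 3 τ₂ (curL (flat115 Y))` for Landau Hermitian `ιY`; instances ★★★`pair27_DeltaPiSlot_eq_hessPair`,
  `pair27_DeltaPiSlotP_eq_hessPair`, `pair27_DeltaEtaSlot_eq_hessPair`; and the `∀ Y, P Y → …` member text `h74_member_DeltaPiSlot` ∕ `h74_member_DeltaPiSlotP`.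
HONEST SCOPE.  Index ∕ units bookkeeping and linear algebra over landed letters; exact background; no estimate; (r79), `hPT` and the regime rows of the lattice (84) are NOT here; not a
proof of any stub; nothing continuum ∕ OS ∕ mass-gap ∕ Clay.

References: T. Bałaban, CMP **102** (1985) 277–309 [Balaban1985Variational] ((74) p.289, (81), (84) p.290, (87) p.291, (76)–(77) p.289); CMP **99** (1985) 389–434
[Balaban1985BackgroundPropagators] ((3.3)–(3.5) p.390–391, (3.10)–(3.12) p.392, (3.118)–(3.120) p.419, (3.122) p.420).
-/

set_option autoImplicit false

noncomputable section

open scoped InnerProductSpace ComplexConjugate Matrix.Norms.L2Operator BigOperators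
open Complex (I)

namespace Summit.QuantumFields.YangMills.Theorems.Prop7Row74AtMember

open Literature.MathematicalPhysics.QuantumFieldTheory.Balaban1983to89
open Literature.MathematicalPhysics.QuantumFieldTheory.Balaban1983to89.T3ContinuumYM3Torus
open B4Sect5Torus (TSite)
open B9SectCLatticeCarrier (Bond)
open B9TorusCalculus (torusT torusT_apply)
open B9Eq37Insertion (reC imC)
open B9Eq39Adjoint (R covD curl curlη plaqU lettersA posPlaq bondPair bondPair_divPη_curlη deltaPrime hessPair)
open Beta.TransportVertices (commSum)
open B11Eq115Space (NegSize Space115 JetSup NegSup)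
open B11Eq111FrakG (nabla115)
open B11Eq103H1Complex (SiteL2K BondL2K funEquiv)
open B11Eq90Transpose (pair27)
open B11Eq90V0primeCurrent (Tsh Ucur curL curL_apply flat115 flat115_apply)
open B9Eq3119DeltaPiCarrier (currentCLM)
open T3SectALandauChart (eta eta_pos bgUnits formComp)
open Summit.QuantumFields.YangMills.Theorems.Prop7SectET3Transport (periodsT3 siteEquiv siteEquiv_shiftEquiv bondEquiv bondEquiv_apply cfgEquiv cfgEquiv_apply bgOfCfg)
open Summit.QuantumFields.YangMills.Theorems.Prop7SectET3HilbertLetters (W₂ frobEquiv toL2 DL2 DstarL2)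
open Summit.QuantumFields.YangMills.Theorems.Prop7SectET3GaugeProjector (NS RS)
open Summit.QuantumFields.YangMills.Theorems.Prop7SectET3CurvedPropagators
open Summit.QuantumFields.YangMills.Theorems.Prop7SectET3DeltaPi
open Summit.QuantumFields.YangMills.Theorems.Prop7SectET3DeltaPiPInv (gaugeCorrP DeltaPiP DeltaPiSlotP gaugeCorrP_apply inner_DeltaPiP DeltaPiSlotP_apply)
open Summit.QuantumFields.YangMills.Theorems.Prop7SPrint (IsLandauPrintS isLandauPrintS_iff_RS)
open Summit.QuantumFields.YangMills.Theorems.Prop7SectET3WilsonHessian (DeltaEta DeltaEtaSlot DeltaEtaSlot_apply hessFormRe hessFormRe_conj inner_toL2_DeltaEta_toL2)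
open Summit.QuantumFields.YangMills.Theorems.Prop7SectET3HessFormExplicit (hessFormRe_self_eq_neg_hessPair)
open Summit.QuantumFields.YangMills.Theorems.Prop7Crit93OfEq111 (pair27_eq_inner_toL2 toL2_currentCLM)
open Summit.QuantumFields.YangMills.Theorems.Prop7ActionLatticeTransport (plaqU_Tsh_cfgEquiv sum_posPlaq_siteEquiv)

/-! ## §1 Lattice bookkeeping for lit's `hessPair` (3.10) -/

section Lattice

variable {𝔸 : Type*} [NormedRing 𝔸] [NormedAlgebra ℂ 𝔸] [CompleteSpace 𝔸]
variable {S : Type*} [Fintype S] {ι : Type*} [Fintype ι] [LinearOrder ι]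
variable (T : ι → Equiv.Perm S) (U : ι → S → 𝔸ˣ)

omit [CompleteSpace 𝔸] in
/-- `hessPair` is linear in the trace functional: `hessPair T U η d (c•τ) A = c·hessPair T U η d τ A`. [cite: Balaban1985BackgroundPropagators, (3.10)–(3.11) p.392] -/
theorem hessPair_smul_tau (η : ℝ) (d : ℕ) (c : ℂ) (τ : 𝔸 →ₗ[ℂ] ℂ) (A : ι → S → 𝔸) :
    hessPair T U η d (c • τ) A = c * hessPair T U η d τ A := by
  simp only [hessPair, bondPair, deltaPrime, LinearMap.smul_apply, smul_eq_mul, ← mul_add, ← Finset.mul_sum]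
  ring

omit [CompleteSpace 𝔸] in
/-- ★ **HOMOGENEITY OF (3.10) IN THE SPACING**: `hessPair T U η d τ A = η^d·η⁻²·hessPair T U 1 d τ A` (the weight `η^d` of (3.11) and the two `η⁻¹` of `D^η`, resp. the `η⁻²` of `Δ′`).
[cite: Balaban1985BackgroundPropagators, (3.4) p.391, (3.10)–(3.11) p.392] -/
theorem hessPair_eta_scale (τ : 𝔸 →ₗ[ℂ] ℂ) (hτ : ∀ a b : 𝔸, τ (a * b) = τ (b * a)) (η : ℝ) (d : ℕ) (A : ι → S → 𝔸) :
    hessPair T U η d τ A = (η : ℂ) ^ d * ((η : ℂ)⁻¹) ^ 2 * hessPair T U 1 d τ A := by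
  rw [hessPair, hessPair, bondPair_divPη_curlη T U τ hτ, bondPair_divPη_curlη T U τ hτ, deltaPrime, deltaPrime]
  simp only [curlη, Complex.ofReal_one, inv_one, one_pow, one_smul, one_mul, smul_mul_assoc, mul_smul_comm, map_smul, smul_eq_mul, Finset.mul_sum,
    ← Finset.sum_add_distrib]
  refine Finset.sum_congr rfl fun q _ => ?_
  ring

end Lattice

/-! ## §1 (cont.) The two lattice readings of a T³ member agree on `curl`, the letters `A′(b)`, the plaquette variables and `hessPair` -/

section Member

variable {F : T3Family} {n K : ℕ}

/-- `curl` agrees across the two lattice presentations (`TSite` reading at `bgOfCfg F K U₀` vs. route lattice at `bgUnits F K U₀`). [cite: Balaban1985BackgroundPropagators, (3.4) p.391] -/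
theorem curl_Tsh_bgOfCfg (U₀ : GaugeField (F.P K) 0 (Matrix.specialUnitaryGroup (Fin 2) ℂ)) (A : Bond 3 (periodsT3 F K) → Matrix (Fin 2) (Fin 2) ℂ) (μ ν : Fin 3) (x : Site (F.P K) 0) :
    curl Tsh (Ucur (bgOfCfg F K U₀)) (curL A) μ ν (siteEquiv F K x)
      = curl (torusT (F.P K) 0) (fun μ x => bgUnits F K U₀ ⟨x, μ⟩) (formComp fun b : PBond (F.P K) 0 => A (bondEquiv F K b)) μ ν x := by
  have hT : ∀ (κ : Fin 3) (y : Site (F.P K) 0), Tsh κ (siteEquiv F K y) = siteEquiv F K (y.shift κ) :=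
    fun κ y => (siteEquiv_shiftEquiv F K y κ).symm
  have hV : ∀ (κ : Fin 3) (y : Site (F.P K) 0), Ucur (bgOfCfg F K U₀) κ (siteEquiv F K y) = bgUnits F K U₀ ⟨y, κ⟩ := fun κ y => by
    show cfgEquiv F K _ (bgUnits F K U₀) (siteEquiv F K y, κ) = bgUnits F K U₀ ⟨y, κ⟩
    rw [cfgEquiv_apply, Prop7SectET3Transport.bondEquiv_symm_apply, Equiv.symm_apply_apply]
  simp only [curl, covD, curL_apply, hT, hV, torusT_apply, formComp, bondEquiv_apply]
  rfl

/-- The four letters `A′(b)`, `b ⊂ ∂p`, agree across the two lattice presentations. [cite: Balaban1985BackgroundPropagators, (3.2) p.390, (3.5) p.391] -/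
theorem lettersA_Tsh_bgOfCfg (U₀ : GaugeField (F.P K) 0 (Matrix.specialUnitaryGroup (Fin 2) ℂ)) (A : Bond 3 (periodsT3 F K) → Matrix (Fin 2) (Fin 2) ℂ) (μ ν : Fin 3) (x : Site (F.P K) 0) :
    lettersA Tsh (Ucur (bgOfCfg F K U₀)) (curL A) μ ν (siteEquiv F K x)
      = lettersA (torusT (F.P K) 0) (fun μ x => bgUnits F K U₀ ⟨x, μ⟩) (formComp fun b : PBond (F.P K) 0 => A (bondEquiv F K b)) μ ν x := by
  have hT : ∀ (κ : Fin 3) (y : Site (F.P K) 0), Tsh κ (siteEquiv F K y) = siteEquiv F K (y.shift κ) :=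
    fun κ y => (siteEquiv_shiftEquiv F K y κ).symm
  have hV : ∀ (κ : Fin 3) (y : Site (F.P K) 0), Ucur (bgOfCfg F K U₀) κ (siteEquiv F K y) = bgUnits F K U₀ ⟨y, κ⟩ := fun κ y => by
    show cfgEquiv F K _ (bgUnits F K U₀) (siteEquiv F K y, κ) = bgUnits F K U₀ ⟨y, κ⟩
    rw [cfgEquiv_apply, Prop7SectET3Transport.bondEquiv_symm_apply, Equiv.symm_apply_apply]
  simp only [lettersA, curL_apply, hT, hV, torusT_apply, formComp, bondEquiv_apply]
  rfl

/-- The plaquette variables agree across the two lattice presentations (✓`Prop7ActionLatticeTransport.plaqU_Tsh_cfgEquiv` at `V := bgUnits F K U₀`). [cite: Balaban1985BackgroundPropagators, (3.1) p.390] -/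
theorem plaqU_Tsh_bgOfCfg (U₀ : GaugeField (F.P K) 0 (Matrix.specialUnitaryGroup (Fin 2) ℂ)) (μ ν : Fin 3) (x : Site (F.P K) 0) :
    plaqU Tsh (Ucur (bgOfCfg F K U₀)) μ ν (siteEquiv F K x) = plaqU (torusT (F.P K) 0) (fun μ x => bgUnits F K U₀ ⟨x, μ⟩) μ ν x :=
  plaqU_Tsh_cfgEquiv (bgUnits F K U₀) μ ν x

/-- ★★ **`hessPair` AGREES ACROSS THE TWO LATTICE PRESENTATIONS**: lit's `⟨A, ΔA⟩` (3.10) of the `TSite` reading at the background of record `bgOfCfg F K U₀`, applied to `curL A`, IS the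
route lattice's at `bgUnits F K U₀`, applied to `formComp (A ∘ bondEquiv)` — same spacing `η`, any trace functional with `τ(ab) = τ(ba)`. [cite: Balaban1985BackgroundPropagators, (3.10) p.392] -/
theorem hessPair_Tsh_bgOfCfg_eq (τ : Matrix (Fin 2) (Fin 2) ℂ →ₗ[ℂ] ℂ) (hτ : ∀ a b : Matrix (Fin 2) (Fin 2) ℂ, τ (a * b) = τ (b * a))
    (U₀ : GaugeField (F.P K) 0 (Matrix.specialUnitaryGroup (Fin 2) ℂ)) (η : ℝ) (A : Bond 3 (periodsT3 F K) → Matrix (Fin 2) (Fin 2) ℂ) :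
    hessPair Tsh (Ucur (bgOfCfg F K U₀)) η 3 τ (curL A)
      = hessPair (torusT (F.P K) 0) (fun μ x => bgUnits F K U₀ ⟨x, μ⟩) η 3 τ (formComp fun b : PBond (F.P K) 0 => A (bondEquiv F K b)) := by
  rw [hessPair, hessPair, bondPair_divPη_curlη _ _ τ hτ, bondPair_divPη_curlη _ _ τ hτ, deltaPrime, deltaPrime,
    sum_posPlaq_siteEquiv (fun μ ν y => τ (curlη Tsh (Ucur (bgOfCfg F K U₀)) η (curL A) μ ν y * curlη Tsh (Ucur (bgOfCfg F K U₀)) η (curL A) μ ν y)),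
    sum_posPlaq_siteEquiv (fun μ ν y =>
      τ (curl Tsh (Ucur (bgOfCfg F K U₀)) (curL A) μ ν y * curl Tsh (Ucur (bgOfCfg F K U₀)) (curL A) μ ν y * ((((η : ℂ)⁻¹) ^ 2) • (reC (plaqU Tsh (Ucur (bgOfCfg F K U₀)) μ ν y) - 1)))
        + τ ((I • commSum (lettersA Tsh (Ucur (bgOfCfg F K U₀)) (curL A) μ ν y)) * ((((η : ℂ)⁻¹) ^ 2) • imC (plaqU Tsh (Ucur (bgOfCfg F K U₀)) μ ν y))))]
  simp only [curlη, curl_Tsh_bgOfCfg, lettersA_Tsh_bgOfCfg, plaqU_Tsh_bgOfCfg]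

end Member

/-! ## §2 (3.119) in `L²` letters: `P v = v` and `⟪v′, Δ_π v⟫ = ⟪v′, Δ^η v⟫` on the Landau subspace; the diagonal of `Δ^η` on Hermitian fields is lit's `hessPair` -/

section L2

variable {F : T3Family} {n K : ℕ} {h : n ≤ K} {c₀ cB a : ℝ} [Fact (0 < c₀)] [Fact (0 < cB)]

/-- **`P v = v` ON THE LANDAU SUBSPACE** (`P = 1 − DG′R_SD*`, `R_SD*v = 0`). [cite: Balaban1985BackgroundPropagators, (3.119) p.419] -/
theorem gaugeCorr_eq_self_of_landau (U₀ : GaugeField (F.P K) 0 (Matrix.specialUnitaryGroup (Fin 2) ℂ)) {v : BondL2K ℂ 3 (periodsT3 F K) c₀ W₂}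
    (hv : RS F n K h c₀ cB U₀ (DstarL2 F n K c₀ U₀ v) = 0) : gaugeCorr F n K h c₀ cB a U₀ v = v := by
  rw [gaugeCorr_apply, hv, map_zero, map_zero, sub_zero]

/-- **`Pᴾ v = v` ON THE LANDAU SUBSPACE** (pinv twin, ★★OWNER RULING g28-№4 (C2′)). [cite: Balaban1985BackgroundPropagators, (3.119) p.419] -/
theorem gaugeCorrP_eq_self_of_landau (U₀ : GaugeField (F.P K) 0 (Matrix.specialUnitaryGroup (Fin 2) ℂ)) {v : BondL2K ℂ 3 (periodsT3 F K) c₀ W₂}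
    (hv : RS F n K h c₀ cB U₀ (DstarL2 F n K c₀ U₀ v) = 0) : gaugeCorrP F n K h c₀ cB a U₀ v = v := by
  rw [gaugeCorrP_apply, hv, map_zero, map_zero, sub_zero]

/-- ★ **(3.119) ∕ (87) «⟨A′, Δ_πA⟩ = ⟨A′, ΔA⟩ for A′, A in the Landau subspace».** [cite: Balaban1985BackgroundPropagators, (3.119) p.419; Balaban1985Variational, (87) p.291] -/
theorem inner_DeltaPi_of_landau (U₀ : GaugeField (F.P K) 0 (Matrix.specialUnitaryGroup (Fin 2) ℂ)) {v' v : BondL2K ℂ 3 (periodsT3 F K) c₀ W₂}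
    (hv' : RS F n K h c₀ cB U₀ (DstarL2 F n K c₀ U₀ v') = 0) (hv : RS F n K h c₀ cB U₀ (DstarL2 F n K c₀ U₀ v) = 0) :
    ⟪v', DeltaPi F n K h c₀ cB a U₀ v⟫_ℂ = ⟪v', DeltaEta F n K c₀ U₀ v⟫_ℂ := by
  rw [inner_DeltaPi, gaugeCorr_eq_self_of_landau U₀ hv', gaugeCorr_eq_self_of_landau U₀ hv]

/-- ★ (3.119) ∕ (87) at the pinv letter `Δ_πᴾ`. [cite: Balaban1985BackgroundPropagators, (3.119) p.419; Balaban1985Variational, (87) p.291] -/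
theorem inner_DeltaPiP_of_landau (U₀ : GaugeField (F.P K) 0 (Matrix.specialUnitaryGroup (Fin 2) ℂ)) {v' v : BondL2K ℂ 3 (periodsT3 F K) c₀ W₂}
    (hv' : RS F n K h c₀ cB U₀ (DstarL2 F n K c₀ U₀ v') = 0) (hv : RS F n K h c₀ cB U₀ (DstarL2 F n K c₀ U₀ v) = 0) :
    ⟪v', DeltaPiP F n K h c₀ cB a U₀ v⟫_ℂ = ⟪v', DeltaEta F n K c₀ U₀ v⟫_ℂ := by
  rw [inner_DeltaPiP, gaugeCorrP_eq_self_of_landau U₀ hv', gaugeCorrP_eq_self_of_landau U₀ hv]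

/-- ★★ **THE DIAGONAL OF `Δ^η(U₀)` ON A HERMITIAN EXPONENT FIELD IS LIT'S (3.10)**: `⟪toL2 X, Δ^η(U₀)(toL2 X)⟫ = (c₀∕η²)·hessPair torusT (bgUnits U₀) 1 3 tr (formComp X)` for `Xᴴ = X`
(print's normalisation (3.11)–(3.12): `⟪·,·⟫ = c₀Σtr`, `⟨A, ΔA⟩` with `½tr`; reality of the form on Hermitian directions). [cite: Balaban1985BackgroundPropagators, (3.10)–(3.12) p.392] -/
theorem inner_toL2_DeltaEta_toL2_eq_hessPair (U₀ : GaugeField (F.P K) 0 (Matrix.specialUnitaryGroup (Fin 2) ℂ)) {X : PBond (F.P K) 0 → Matrix (Fin 2) (Fin 2) ℂ} (hX : star X = X) :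
    ⟪toL2 F K c₀ X, DeltaEta F n K c₀ U₀ (toL2 F K c₀ X)⟫_ℂ
      = ((c₀ : ℂ) / (((eta F n K : ℝ) : ℂ)) ^ 2) *
          hessPair (torusT (F.P K) 0) (fun μ x => bgUnits F K U₀ ⟨x, μ⟩) 1 3
            ((LinearMap.toContinuousLinearMap (Matrix.traceLinearMap (Fin 2) ℂ ℂ) : Matrix (Fin 2) (Fin 2) ℂ →L[ℂ] ℂ) : Matrix (Fin 2) (Fin 2) ℂ →ₗ[ℂ] ℂ) (formComp X) := by
  have hreal : conj (hessFormRe F K U₀ X X) = hessFormRe F K U₀ X X := by rw [hessFormRe_conj, hX]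
  rw [inner_toL2_DeltaEta_toL2, hX, hreal, hessFormRe_self_eq_neg_hessPair, hessPair_smul_tau]
  ring

end L2

/-! ## §3 The row (r74) of the lattice (84) at the member -/

section Row74

variable {F : T3Family} {n K : ℕ} {h : n ≤ K} {c₀ cB a : ℝ} [Fact (0 < c₀)]
variable [Fact (0 < (F.L : ℝ))] [Fact (0 < ((F.L : ℝ)⁻¹) ^ (K - n))]

/-- ★★★ **(r74) AT THE MEMBER, GENERIC SLOT**: for an `L²` operator `T` agreeing with `Δ^η(U₀)` as a quadratic form on the Landau subspace (`hT`) and a (115)-field `Y` whose exponent reading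
`ιY = (JetSup.equiv Y) ∘ bondEquiv` is Hermitian and Landau, lit's (84)-row (r74) holds: `pair27 tr (T̂ Y) (flat115 Y) = hessPair Tsh (Ucur (bgOfCfg F K U₀)) η 3 tr (curL (flat115 Y))`.
[cite: Balaban1985Variational, (74) p.289, (87) p.291; Balaban1985BackgroundPropagators, (3.10)–(3.12) p.392, (3.119) p.419] -/
theorem pair27_eq_hessPair_of_landau (U₀ : GaugeField (F.P K) 0 (Matrix.specialUnitaryGroup (Fin 2) ℂ))
    (T : BondL2K ℂ 3 (periodsT3 F K) c₀ W₂ →ₗ[ℂ] BondL2K ℂ 3 (periodsT3 F K) c₀ W₂)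
    (hT : ∀ v : BondL2K ℂ 3 (periodsT3 F K) c₀ W₂, RS F n K h c₀ cB U₀ (DstarL2 F n K c₀ U₀ v) = 0 → ⟪v, T v⟫_ℂ = ⟪v, DeltaEta F n K c₀ U₀ v⟫_ℂ)
    (Y : Space115 (F.L : ℝ) (((F.L : ℝ)⁻¹) ^ (K - n)) (fun _ : Bond 3 (periodsT3 F K) => K - n) (fun _ : Bond 3 (periodsT3 F K) × Fin 3 => K - n)
      (nabla115 (((F.L : ℝ)⁻¹) ^ (K - n)) (bgOfCfg F K U₀)))
    (hR : ∀ b : PBond (F.P K) 0, star (JetSup.equiv _ _ _ Y (bondEquiv F K b)) = JetSup.equiv _ _ _ Y (bondEquiv F K b))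
    (hL : IsLandauPrintS F n K h c₀ cB U₀ (fun b : PBond (F.P K) 0 => JetSup.equiv _ _ _ Y (bondEquiv F K b))) :
    pair27 (LinearMap.toContinuousLinearMap (Matrix.traceLinearMap (Fin 2) ℂ ℂ))
        (currentCLM frobEquiv (fun _ : Bond 3 (periodsT3 F K) × Fin 3 => K - n) (nabla115 (((F.L : ℝ)⁻¹) ^ (K - n)) (bgOfCfg F K U₀)) T Y) (flat115 Y)
      = hessPair Tsh (Ucur (bgOfCfg F K U₀)) (((F.L : ℝ)⁻¹) ^ (K - n)) 3
          ((LinearMap.toContinuousLinearMap (Matrix.traceLinearMap (Fin 2) ℂ ℂ) : Matrix (Fin 2) (Fin 2) ℂ →L[ℂ] ℂ) : Matrix (Fin 2) (Fin 2) ℂ →ₗ[ℂ] ℂ) (curL (flat115 Y)) := by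
  have hτ : ∀ a b : Matrix (Fin 2) (Fin 2) ℂ,
      ((LinearMap.toContinuousLinearMap (Matrix.traceLinearMap (Fin 2) ℂ ℂ) : Matrix (Fin 2) (Fin 2) ℂ →L[ℂ] ℂ) : Matrix (Fin 2) (Fin 2) ℂ →ₗ[ℂ] ℂ) (a * b)
        = ((LinearMap.toContinuousLinearMap (Matrix.traceLinearMap (Fin 2) ℂ ℂ) : Matrix (Fin 2) (Fin 2) ℂ →L[ℂ] ℂ) : Matrix (Fin 2) (Fin 2) ℂ →ₗ[ℂ] ℂ) (b * a) := fun a b => by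
    simp only [LinearMap.coe_toContinuousLinearMap, Matrix.traceLinearMap_apply, Matrix.trace_mul_comm a b]
  have hstar : star (fun b : PBond (F.P K) 0 => JetSup.equiv _ _ _ Y (bondEquiv F K b)) = fun b : PBond (F.P K) 0 => JetSup.equiv _ _ _ Y (bondEquiv F K b) := funext hR
  have hflat : (fun b : PBond (F.P K) 0 => flat115 Y (bondEquiv F K b)) = fun b : PBond (F.P K) 0 => JetSup.equiv _ _ _ Y (bondEquiv F K b) := rfl
  have hv : RS F n K h c₀ cB U₀ (DstarL2 F n K c₀ U₀ (toL2 F K c₀ (fun b : PBond (F.P K) 0 => JetSup.equiv _ _ _ Y (bondEquiv F K b)))) = 0 := (isLandauPrintS_iff_RS U₀ _).1 hL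
  have hη : (((eta F n K : ℝ) : ℂ)) = ((((F.L : ℝ)⁻¹) ^ (K - n) : ℝ) : ℂ) := rfl
  have hη0 : ((((F.L : ℝ)⁻¹) ^ (K - n) : ℝ) : ℂ) ≠ 0 := Complex.ofReal_ne_zero.2 (Fact.out : 0 < ((F.L : ℝ)⁻¹) ^ (K - n)).ne'
  have hc : (c₀ : ℂ) ≠ 0 := Complex.ofReal_ne_zero.2 (Fact.out : 0 < c₀).ne'
  rw [pair27_eq_inner_toL2 (c₀ := c₀), toL2_currentCLM, hflat, hstar, hT _ hv, inner_toL2_DeltaEta_toL2_eq_hessPair U₀ hstar, hη,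
    hessPair_Tsh_bgOfCfg_eq _ hτ, hessPair_eta_scale _ _ _ hτ (((F.L : ℝ)⁻¹) ^ (K - n)) 3]
  field_simp
  rfl

/-- ★★★ **(r74) AT THE MEMBER, SLOT `Δ_π = DeltaPiSlot`** ((3.119): `⟪v, Δ_πv⟫ = ⟪v, Δ^ηv⟫` on Landau `v`). [cite: Balaban1985Variational, (74) p.289, (87) p.291; Balaban1985BackgroundPropagators, (3.119) p.419] -/
theorem pair27_DeltaPiSlot_eq_hessPair [Fact (0 < cB)] (U₀ : GaugeField (F.P K) 0 (Matrix.specialUnitaryGroup (Fin 2) ℂ))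
    (Y : Space115 (F.L : ℝ) (((F.L : ℝ)⁻¹) ^ (K - n)) (fun _ : Bond 3 (periodsT3 F K) => K - n) (fun _ : Bond 3 (periodsT3 F K) × Fin 3 => K - n)
      (nabla115 (((F.L : ℝ)⁻¹) ^ (K - n)) (bgOfCfg F K U₀)))
    (hR : ∀ b : PBond (F.P K) 0, star (JetSup.equiv _ _ _ Y (bondEquiv F K b)) = JetSup.equiv _ _ _ Y (bondEquiv F K b))
    (hL : IsLandauPrintS F n K h c₀ cB U₀ (fun b : PBond (F.P K) 0 => JetSup.equiv _ _ _ Y (bondEquiv F K b))) :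
    pair27 (LinearMap.toContinuousLinearMap (Matrix.traceLinearMap (Fin 2) ℂ ℂ))
        (currentCLM frobEquiv (fun _ : Bond 3 (periodsT3 F K) × Fin 3 => K - n) (nabla115 (((F.L : ℝ)⁻¹) ^ (K - n)) (bgOfCfg F K U₀)) (DeltaPiSlot F n K h c₀ cB a U₀) Y)
        (flat115 Y)
      = hessPair Tsh (Ucur (bgOfCfg F K U₀)) (((F.L : ℝ)⁻¹) ^ (K - n)) 3
          ((LinearMap.toContinuousLinearMap (Matrix.traceLinearMap (Fin 2) ℂ ℂ) : Matrix (Fin 2) (Fin 2) ℂ →L[ℂ] ℂ) : Matrix (Fin 2) (Fin 2) ℂ →ₗ[ℂ] ℂ) (curL (flat115 Y)) :=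
  pair27_eq_hessPair_of_landau U₀ _ (fun v hv => by rw [DeltaPiSlot_apply]; exact inner_DeltaPi_of_landau U₀ hv hv) Y hR hL

/-- (r74) at the member, pinv slot `Δ_πᴾ = DeltaPiSlotP` (★★OWNER RULING g28-№4 (C2′); the EX display's slot after the PINV cascade).
[cite: Balaban1985Variational, (74) p.289, (87) p.291; Balaban1985BackgroundPropagators, (3.119) p.419] -/
theorem pair27_DeltaPiSlotP_eq_hessPair [Fact (0 < cB)] (U₀ : GaugeField (F.P K) 0 (Matrix.specialUnitaryGroup (Fin 2) ℂ))
    (Y : Space115 (F.L : ℝ) (((F.L : ℝ)⁻¹) ^ (K - n)) (fun _ : Bond 3 (periodsT3 F K) => K - n) (fun _ : Bond 3 (periodsT3 F K) × Fin 3 => K - n)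
      (nabla115 (((F.L : ℝ)⁻¹) ^ (K - n)) (bgOfCfg F K U₀)))
    (hR : ∀ b : PBond (F.P K) 0, star (JetSup.equiv _ _ _ Y (bondEquiv F K b)) = JetSup.equiv _ _ _ Y (bondEquiv F K b))
    (hL : IsLandauPrintS F n K h c₀ cB U₀ (fun b : PBond (F.P K) 0 => JetSup.equiv _ _ _ Y (bondEquiv F K b))) :
    pair27 (LinearMap.toContinuousLinearMap (Matrix.traceLinearMap (Fin 2) ℂ ℂ))
        (currentCLM frobEquiv (fun _ : Bond 3 (periodsT3 F K) × Fin 3 => K - n) (nabla115 (((F.L : ℝ)⁻¹) ^ (K - n)) (bgOfCfg F K U₀)) (DeltaPiSlotP F n K h c₀ cB a U₀) Y)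
        (flat115 Y)
      = hessPair Tsh (Ucur (bgOfCfg F K U₀)) (((F.L : ℝ)⁻¹) ^ (K - n)) 3
          ((LinearMap.toContinuousLinearMap (Matrix.traceLinearMap (Fin 2) ℂ ℂ) : Matrix (Fin 2) (Fin 2) ℂ →L[ℂ] ℂ) : Matrix (Fin 2) (Fin 2) ℂ →ₗ[ℂ] ℂ) (curL (flat115 Y)) :=
  pair27_eq_hessPair_of_landau U₀ _ (fun v hv => by rw [DeltaPiSlotP_apply]; exact inner_DeltaPiP_of_landau U₀ hv hv) Y hR hL

/-- (r74) at the member, slot `Δ^η = DeltaEtaSlot` itself (trivially; recorded for the slot-generic consumers). [cite: Balaban1985BackgroundPropagators, (3.10)–(3.12) p.392] -/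
theorem pair27_DeltaEtaSlot_eq_hessPair (U₀ : GaugeField (F.P K) 0 (Matrix.specialUnitaryGroup (Fin 2) ℂ))
    (Y : Space115 (F.L : ℝ) (((F.L : ℝ)⁻¹) ^ (K - n)) (fun _ : Bond 3 (periodsT3 F K) => K - n) (fun _ : Bond 3 (periodsT3 F K) × Fin 3 => K - n)
      (nabla115 (((F.L : ℝ)⁻¹) ^ (K - n)) (bgOfCfg F K U₀)))
    (hR : ∀ b : PBond (F.P K) 0, star (JetSup.equiv _ _ _ Y (bondEquiv F K b)) = JetSup.equiv _ _ _ Y (bondEquiv F K b))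
    (hL : IsLandauPrintS F n K h c₀ cB U₀ (fun b : PBond (F.P K) 0 => JetSup.equiv _ _ _ Y (bondEquiv F K b))) :
    pair27 (LinearMap.toContinuousLinearMap (Matrix.traceLinearMap (Fin 2) ℂ ℂ))
        (currentCLM frobEquiv (fun _ : Bond 3 (periodsT3 F K) × Fin 3 => K - n) (nabla115 (((F.L : ℝ)⁻¹) ^ (K - n)) (bgOfCfg F K U₀)) (DeltaEtaSlot F n K c₀ U₀) Y)
        (flat115 Y)
      = hessPair Tsh (Ucur (bgOfCfg F K U₀)) (((F.L : ℝ)⁻¹) ^ (K - n)) 3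
          ((LinearMap.toContinuousLinearMap (Matrix.traceLinearMap (Fin 2) ℂ ℂ) : Matrix (Fin 2) (Fin 2) ℂ →L[ℂ] ℂ) : Matrix (Fin 2) (Fin 2) ℂ →ₗ[ℂ] ℂ) (curL (flat115 Y)) :=
  pair27_eq_hessPair_of_landau (h := h) (cB := cB) U₀ _ (fun v _ => by rw [DeltaEtaSlot_apply]) Y hR hL

/-- ★★ **THE MEMBER TEXT OF lit `hasDerivAt_actionZ_chartRay_real`'s HYPOTHESIS `h74`** at `Δπ := currentCLM … (DeltaPiSlot … U₀)` and the gauge predicate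
`P Y := IsLandauPrintS … U₀ (ιY) ∧ ∀ b, star (ιY b) = ιY b` (Landau + Hermitian exponent reading). [cite: Balaban1985Variational, (74) p.289, (76)–(77) p.289, (87) p.291] -/
theorem h74_member_DeltaPiSlot [Fact (0 < cB)] (U₀ : GaugeField (F.P K) 0 (Matrix.specialUnitaryGroup (Fin 2) ℂ)) :
    ∀ Y : Space115 (F.L : ℝ) (((F.L : ℝ)⁻¹) ^ (K - n)) (fun _ : Bond 3 (periodsT3 F K) => K - n) (fun _ : Bond 3 (periodsT3 F K) × Fin 3 => K - n)
        (nabla115 (((F.L : ℝ)⁻¹) ^ (K - n)) (bgOfCfg F K U₀)),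
      (IsLandauPrintS F n K h c₀ cB U₀ (fun b : PBond (F.P K) 0 => JetSup.equiv _ _ _ Y (bondEquiv F K b))
          ∧ ∀ b : PBond (F.P K) 0, star (JetSup.equiv _ _ _ Y (bondEquiv F K b)) = JetSup.equiv _ _ _ Y (bondEquiv F K b)) →
        pair27 (LinearMap.toContinuousLinearMap (Matrix.traceLinearMap (Fin 2) ℂ ℂ))
            (currentCLM frobEquiv (fun _ : Bond 3 (periodsT3 F K) × Fin 3 => K - n) (nabla115 (((F.L : ℝ)⁻¹) ^ (K - n)) (bgOfCfg F K U₀)) (DeltaPiSlot F n K h c₀ cB a U₀) Y)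
            (flat115 Y)
          = hessPair Tsh (Ucur (bgOfCfg F K U₀)) (((F.L : ℝ)⁻¹) ^ (K - n)) 3
              ((LinearMap.toContinuousLinearMap (Matrix.traceLinearMap (Fin 2) ℂ ℂ) : Matrix (Fin 2) (Fin 2) ℂ →L[ℂ] ℂ) : Matrix (Fin 2) (Fin 2) ℂ →ₗ[ℂ] ℂ) (curL (flat115 Y)) :=
  fun Y hP => pair27_DeltaPiSlot_eq_hessPair U₀ Y hP.2 hP.1

/-- ★★ The same member text at the pinv slot `DeltaPiSlotP` (the EX display's slot after the PINV cascade, ★★OWNER RULING g28-№4 (C2′)).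
[cite: Balaban1985Variational, (74) p.289, (76)–(77) p.289, (87) p.291] -/
theorem h74_member_DeltaPiSlotP [Fact (0 < cB)] (U₀ : GaugeField (F.P K) 0 (Matrix.specialUnitaryGroup (Fin 2) ℂ)) :
    ∀ Y : Space115 (F.L : ℝ) (((F.L : ℝ)⁻¹) ^ (K - n)) (fun _ : Bond 3 (periodsT3 F K) => K - n) (fun _ : Bond 3 (periodsT3 F K) × Fin 3 => K - n)
        (nabla115 (((F.L : ℝ)⁻¹) ^ (K - n)) (bgOfCfg F K U₀)),
      (IsLandauPrintS F n K h c₀ cB U₀ (fun b : PBond (F.P K) 0 => JetSup.equiv _ _ _ Y (bondEquiv F K b))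
          ∧ ∀ b : PBond (F.P K) 0, star (JetSup.equiv _ _ _ Y (bondEquiv F K b)) = JetSup.equiv _ _ _ Y (bondEquiv F K b)) →
        pair27 (LinearMap.toContinuousLinearMap (Matrix.traceLinearMap (Fin 2) ℂ ℂ))
            (currentCLM frobEquiv (fun _ : Bond 3 (periodsT3 F K) × Fin 3 => K - n) (nabla115 (((F.L : ℝ)⁻¹) ^ (K - n)) (bgOfCfg F K U₀)) (DeltaPiSlotP F n K h c₀ cB a U₀) Y)
            (flat115 Y)
          = hessPair Tsh (Ucur (bgOfCfg F K U₀)) (((F.L : ℝ)⁻¹) ^ (K - n)) 3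
              ((LinearMap.toContinuousLinearMap (Matrix.traceLinearMap (Fin 2) ℂ ℂ) : Matrix (Fin 2) (Fin 2) ℂ →L[ℂ] ℂ) : Matrix (Fin 2) (Fin 2) ℂ →ₗ[ℂ] ℂ) (curL (flat115 Y)) :=
  fun Y hP => pair27_DeltaPiSlotP_eq_hessPair U₀ Y hP.2 hP.1

end Row74

end Summit.QuantumFields.YangMills.Theorems.Prop7Row74AtMember

end
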